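import Summits.Ventures.Crystal3D.Theorems.StickyWulffConstantGenericWallFloorHollowPatch
import HarnessLib
import Literature.Geometry.DiscreteGeometry.OneSidedKissingNumberThree

/-!
# A ball resting in a hollow of a complete layer patch, part 2: given Kertész's nine-point theorem, twelve contacts force the whole
# in-plane hollow ring (crux `GenericWallFloor`, stmt-Ventures-19480, line `WallLedgerG`; the first certified input beyond `P5Exhaustion`
# for the twin-position blockers of the §51 rows, memo HONEST-LAMBDA-g12 §4(a))

HONEST FRAMING. Venture `Summits/Ventures/Crystal3D` (cell `crystal3d-full`), helper `--supports` the crux `GenericWallFloor`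
(stmt-Ventures-19480) of `route-Ventures-StickyWulffConstant`, REGISTERED line `WallLedgerG`, open stub `stub_twoSlabAdhesion`.
Rung credit only; F-C1 not moved; NOT the stub.  CONDITIONAL on the named Literature fact `kertesz1994_nineHemisphere` (Kertész 1994,
stated below with its locator; not proved in the tree).

SETTING as in part 1 (…GenericWallFloorHollowPatch), moved by an arbitrary linear isometry `F` to the ball `f`: the six patch points
`f + F dₖ` are balls of the `1`-separated configuration `X`; the hollow ring is `f ± F(1,0,0)`, `f ± F(½, √3/2, 0)`, `f ± F(½, −√3/2, 0)`.

* `kertesz1994_nineHemisphere` — NAMED FACT (Kertész 1994): nine unit vectors in a closed hemisphere pairwise at chordal distance `≥ 1`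
  have at least six on the boundary great circle (uniqueness of the maximal one-sided kissing arrangement, `B(3) = 9`).
* **`hollowRing_subset_of_twelve_contacts`** — if such an `f` has TWELVE contacts, its nine non-support contacts lie in the closed upper
  half-space through `f` (`coord_two_nonneg_of_hollowPatch`), six of them in the plane of `f` (the named fact), hence at ring sites
  (`mem_hollowRing_of_boundary`): the WHOLE hollow ring is in `X`.
* **`card_contacts_le_eleven_of_hollowRing_vacancy`** — contrapositive: a hollow ball over a complete patch with ONE ring site not in `X` has
  at most eleven contacts — a CERTIFIED payer.  On the «(9,2) honeycomb» decoration of the memo every hollow blocker has three empty ring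
  sites, so this row certifies each of them (credit `≥ 1`, shared by the `≤ 3` end balls under it).
WHAT THIS IS NOT: Kertész's theorem is not proved here; no ledger arithmetic; F-C1 not moved.
-/

noncomputable section

namespace Summit.Ventures.Crystal3D.Theorems

open Finset
open scoped InnerProductSpace

variable {X : Finset (EuclideanSpace ℝ (Fin 3))}

/-! ### The named fact -/

open scoped Classical in
/-- **Twelve contacts force the whole hollow ring** (conditional on Kertész's theorem).  `X` is `1`-separated, the ball `f` rests in a hollow
of a complete layer patch moved by the frame `F` (the six patch points `f + F dₖ` are in `X`), and `f` has twelve contacts.  Then the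
nine non-support contacts lie in the closed upper half-space through `f` (`coord_two_nonneg_of_hollowPatch`); by the named fact six of them
lie in the plane of `f`; by `mem_hollowRing_of_boundary` they are at ring sites — so ALL SIX ring sites `f ± F(1,0,0)`, `f ± F(½,√3/2,0)`,
`f ± F(½,−√3/2,0)` are balls of `X`. -/
theorem hollowRing_subset_of_twelve_contacts (hK : Literature.Geometry.DiscreteGeometry.kertesz1994_nineHemisphere)
    (hX : ∀ p ∈ X, ∀ q ∈ X, p ≠ q → 1 ≤ dist p q)
    (F : EuclideanSpace ℝ (Fin 3) ≃ₗᵢ[ℝ] EuclideanSpace ℝ (Fin 3)) {f : EuclideanSpace ℝ (Fin 3)}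
    (h₁ : f + F !₂[-(1 / 2), -(Real.sqrt 3 / 6), -Real.sqrt (2 / 3)] ∈ X)
    (h₂ : f + F !₂[1 / 2, -(Real.sqrt 3 / 6), -Real.sqrt (2 / 3)] ∈ X)
    (h₃ : f + F !₂[0, Real.sqrt 3 / 3, -Real.sqrt (2 / 3)] ∈ X)
    (h₄ : f + F !₂[1, Real.sqrt 3 / 3, -Real.sqrt (2 / 3)] ∈ X)
    (h₅ : f + F !₂[-1, Real.sqrt 3 / 3, -Real.sqrt (2 / 3)] ∈ X)
    (h₆ : f + F !₂[0, -(2 * Real.sqrt 3 / 3), -Real.sqrt (2 / 3)] ∈ X)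
    (hfull : (X.filter fun q => dist f q = 1).card = 12) :
    ∀ r ∈ ({!₂[1, 0, 0], !₂[-1, 0, 0], !₂[1 / 2, Real.sqrt 3 / 2, 0], !₂[-(1 / 2), -(Real.sqrt 3 / 2), 0],
      !₂[1 / 2, -(Real.sqrt 3 / 2), 0], !₂[-(1 / 2), Real.sqrt 3 / 2, 0]} : Finset (EuclideanSpace ℝ (Fin 3))),
      f + F r ∈ X := by
  obtain ⟨hs, hs0, ht, ht0⟩ := sqrt_three_sqrt_twoThirds_facts
  set N := X.filter fun q => dist f q = 1 with hN
  -- the six patch vectors and their norms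
  set d₁ : EuclideanSpace ℝ (Fin 3) := !₂[-(1 / 2), -(Real.sqrt 3 / 6), -Real.sqrt (2 / 3)] with hd₁
  set d₂ : EuclideanSpace ℝ (Fin 3) := !₂[1 / 2, -(Real.sqrt 3 / 6), -Real.sqrt (2 / 3)] with hd₂
  set d₃ : EuclideanSpace ℝ (Fin 3) := !₂[0, Real.sqrt 3 / 3, -Real.sqrt (2 / 3)] with hd₃
  set d₄ : EuclideanSpace ℝ (Fin 3) := !₂[1, Real.sqrt 3 / 3, -Real.sqrt (2 / 3)] with hd₄
  set d₅ : EuclideanSpace ℝ (Fin 3) := !₂[-1, Real.sqrt 3 / 3, -Real.sqrt (2 / 3)] with hd₅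
  set d₆ : EuclideanSpace ℝ (Fin 3) := !₂[0, -(2 * Real.sqrt 3 / 3), -Real.sqrt (2 / 3)] with hd₆
  have norm_vec3_sq : ∀ a b c : ℝ, ‖(!₂[a, b, c] : EuclideanSpace ℝ (Fin 3))‖ ^ 2 = a ^ 2 + b ^ 2 + c ^ 2 := fun a b c => by
    rw [Literature.Algebra.EuclideanLattices.norm_sq_fin_three]; simp
  have hone : ∀ {d : EuclideanSpace ℝ (Fin 3)}, ‖d‖ ^ 2 = 1 → ‖d‖ = 1 := fun h =>
    (pow_eq_one_iff_of_nonneg (norm_nonneg _) two_ne_zero).1 h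
  have hn₁ : ‖d₁‖ = 1 := hone (by rw [hd₁, norm_vec3_sq]; nlinarith [hs, ht])
  have hn₂ : ‖d₂‖ = 1 := hone (by rw [hd₂, norm_vec3_sq]; nlinarith [hs, ht])
  have hn₃ : ‖d₃‖ = 1 := hone (by rw [hd₃, norm_vec3_sq]; nlinarith [hs, ht])
  have hsq2 : ∀ {d : EuclideanSpace ℝ (Fin 3)}, ‖d‖ ^ 2 = 2 → ‖d‖ ≠ 1 := fun h h1 => by rw [h1] at h; norm_num at h
  have hn₄ : ‖d₄‖ ≠ 1 := hsq2 (by rw [hd₄, norm_vec3_sq]; nlinarith [hs, ht])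
  have hn₅ : ‖d₅‖ ≠ 1 := hsq2 (by rw [hd₅, norm_vec3_sq]; nlinarith [hs, ht])
  have hn₆ : ‖d₆‖ ≠ 1 := hsq2 (by rw [hd₆, norm_vec3_sq]; nlinarith [hs, ht])
  -- distance from `f` to a translate
  have hdist : ∀ d : EuclideanSpace ℝ (Fin 3), dist f (f + F d) = ‖d‖ := fun d => by
    rw [dist_eq_norm, sub_add_cancel_left, norm_neg, LinearIsometryEquiv.norm_map]
  -- the three supports are contacts
  have hmemN : ∀ {d : EuclideanSpace ℝ (Fin 3)}, f + F d ∈ X → ‖d‖ = 1 → f + F d ∈ N := fun h hn =>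
    Finset.mem_filter.2 ⟨h, by rw [hdist, hn]⟩
  have hs₁ := hmemN h₁ hn₁; have hs₂ := hmemN h₂ hn₂; have hs₃ := hmemN h₃ hn₃
  -- the pulled-back contact vector and its constraints
  have hpull : ∀ q ∈ N, ‖F.symm (q - f)‖ = 1 ∧ ∀ d : EuclideanSpace ℝ (Fin 3), f + F d ∈ X → q ≠ f + F d →
      1 ≤ ‖F.symm (q - f) - d‖ := by
    intro q hq
    obtain ⟨hqX, hqd⟩ := Finset.mem_filter.1 hq
    refine ⟨by rw [LinearIsometryEquiv.norm_map, ← dist_eq_norm, dist_comm, hqd], fun d hd hne => ?_⟩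
    have e : F.symm (q - f) - d = F.symm (q - (f + F d)) := by
      have : F.symm (q - (f + F d)) = F.symm (q - f) - F.symm (F d) := by
        rw [← map_sub]; congr 1; abel
      rw [this, LinearIsometryEquiv.symm_apply_apply]
    rw [e, LinearIsometryEquiv.norm_map, ← dist_eq_norm]
    exact hX q hqX _ hd hne
  -- the supports are pairwise distinct
  have hcoord : ∀ d : EuclideanSpace ℝ (Fin 3), F.symm (f + F d - f) = d := fun d => by
    rw [add_sub_cancel_left, LinearIsometryEquiv.symm_apply_apply]
  have hd12 : f + F d₁ ≠ f + F d₂ := by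
    intro h; have := congrArg (fun v => (F.symm (v - f)) 0) h
    simp only [hcoord] at this; rw [hd₁, hd₂] at this; simp at this; linarith
  have hd13 : f + F d₁ ≠ f + F d₃ := by
    intro h; have := congrArg (fun v => (F.symm (v - f)) 0) h
    simp only [hcoord] at this; rw [hd₁, hd₃] at this; simp at this
  have hd23 : f + F d₂ ≠ f + F d₃ := by
    intro h; have := congrArg (fun v => (F.symm (v - f)) 0) h
    simp only [hcoord] at this; rw [hd₂, hd₃] at this; simp at this
  -- the nine non-support contacts
  set U := ((N.erase (f + F d₁)).erase (f + F d₂)).erase (f + F d₃) with hU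
  have hUcard : U.card = 9 := by
    have h3 : f + F d₃ ∈ (N.erase (f + F d₁)).erase (f + F d₂) :=
      Finset.mem_erase.2 ⟨hd23.symm, Finset.mem_erase.2 ⟨hd13.symm, hs₃⟩⟩
    have h2 : f + F d₂ ∈ N.erase (f + F d₁) := Finset.mem_erase.2 ⟨hd12.symm, hs₂⟩
    rw [hU, Finset.card_erase_of_mem h3, Finset.card_erase_of_mem h2, Finset.card_erase_of_mem hs₁, hfull]
  have hUN : ∀ q ∈ U, q ∈ N ∧ q ≠ f + F d₁ ∧ q ≠ f + F d₂ ∧ q ≠ f + F d₃ := by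
    intro q hq
    obtain ⟨h3, hq⟩ := Finset.mem_erase.1 hq
    obtain ⟨h2, hq⟩ := Finset.mem_erase.1 hq
    obtain ⟨h1, hq⟩ := Finset.mem_erase.1 hq
    exact ⟨hq, h1, h2, h3⟩
  -- all six distance constraints for `q ∈ U`
  have hsix : ∀ q ∈ U, ‖F.symm (q - f)‖ = 1 ∧
      1 ≤ ‖F.symm (q - f) - d₁‖ ∧ 1 ≤ ‖F.symm (q - f) - d₂‖ ∧ 1 ≤ ‖F.symm (q - f) - d₃‖ ∧
      1 ≤ ‖F.symm (q - f) - d₄‖ ∧ 1 ≤ ‖F.symm (q - f) - d₅‖ ∧ 1 ≤ ‖F.symm (q - f) - d₆‖ := by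
    intro q hq
    obtain ⟨hqN, hq1, hq2, hq3⟩ := hUN q hq
    obtain ⟨hnorm, hcon⟩ := hpull q hqN
    have hqd : dist f q = 1 := (Finset.mem_filter.1 hqN).2
    have hfar : ∀ {d : EuclideanSpace ℝ (Fin 3)}, ‖d‖ ≠ 1 → q ≠ f + F d := fun hd h => hd (by rw [← hdist, ← h, hqd])
    exact ⟨hnorm, hcon d₁ h₁ hq1, hcon d₂ h₂ hq2, hcon d₃ h₃ hq3, hcon d₄ h₄ (hfar hn₄), hcon d₅ h₅ (hfar hn₅),
      hcon d₆ h₆ (hfar hn₆)⟩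
  -- Kertész: six of the nine lie in the plane of `f`
  set e₃ : EuclideanSpace ℝ (Fin 3) := EuclideanSpace.single (2 : Fin 3) (1 : ℝ) with he₃
  have hinner : ∀ v : EuclideanSpace ℝ (Fin 3), ⟪F e₃, v⟫_ℝ = (F.symm v) 2 := fun v => by
    conv_lhs => rw [← LinearIsometryEquiv.apply_symm_apply F v]
    rw [LinearIsometryEquiv.inner_map_map, he₃, EuclideanSpace.inner_single_left]; simp
  have he0 : F e₃ ≠ 0 := by
    intro h
    have h0 : e₃ = 0 := F.injective (by rw [h, map_zero])
    have := congrArg (fun v : EuclideanSpace ℝ (Fin 3) => v 2) h0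
    simp [he₃] at this
  set T := U.image fun q => q - f with hT
  have hTinj : Set.InjOn (fun q : EuclideanSpace ℝ (Fin 3) => q - f) ↑U := fun a _ b _ h => sub_left_injective h
  have hTcard : T.card = 9 := by rw [hT, Finset.card_image_of_injOn hTinj, hUcard]
  have hTunit : ∀ v ∈ T, ‖v‖ = 1 := by
    intro v hv; obtain ⟨q, hq, rfl⟩ := Finset.mem_image.1 hv
    have := (hsix q hq).1; rwa [LinearIsometryEquiv.norm_map] at this
  have hTpos : ∀ v ∈ T, 0 ≤ ⟪F e₃, v⟫_ℝ := by
    intro v hv; obtain ⟨q, hq, rfl⟩ := Finset.mem_image.1 hv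
    obtain ⟨hn, c₁, c₂, c₃, c₄, c₅, c₆⟩ := hsix q hq
    rw [hinner]
    exact coord_two_nonneg_of_hollowPatch _ hn c₁ c₂ c₃ c₄ c₅ c₆
  have hTsep : ∀ v ∈ T, ∀ w ∈ T, v ≠ w → 1 ≤ dist v w := by
    intro v hv w hw hvw
    obtain ⟨q, hq, rfl⟩ := Finset.mem_image.1 hv
    obtain ⟨q', hq', rfl⟩ := Finset.mem_image.1 hw
    have hqq : q ≠ q' := fun h => hvw (by rw [h])
    have e : dist (q - f) (q' - f) = dist q q' := by rw [dist_eq_norm, dist_eq_norm]; congr 1; abel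
    rw [e]
    exact hX q (Finset.mem_filter.1 (hUN q hq).1).1 q' (Finset.mem_filter.1 (hUN q' hq').1).1 hqq
  have hB := hK (F e₃) he0 T hTunit hTpos hTsep hTcard
  set B := T.filter fun v => ⟪F e₃, v⟫_ℝ = 0 with hBdef
  -- the six ring sites
  set SITES := ({!₂[1, 0, 0], !₂[-1, 0, 0], !₂[1 / 2, Real.sqrt 3 / 2, 0], !₂[-(1 / 2), -(Real.sqrt 3 / 2), 0],
      !₂[1 / 2, -(Real.sqrt 3 / 2), 0], !₂[-(1 / 2), Real.sqrt 3 / 2, 0]} : Finset (EuclideanSpace ℝ (Fin 3))).image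
      fun r => f + F r with hSITES
  have hScard : SITES.card ≤ 6 := by
    rw [hSITES]
    refine Finset.card_image_le.trans ?_
    refine (Finset.card_insert_le _ _).trans (Nat.succ_le_succ ?_)
    refine (Finset.card_insert_le _ _).trans (Nat.succ_le_succ ?_)
    refine (Finset.card_insert_le _ _).trans (Nat.succ_le_succ ?_)
    refine (Finset.card_insert_le _ _).trans (Nat.succ_le_succ ?_)
    refine (Finset.card_insert_le _ _).trans (Nat.succ_le_succ ?_)
    rw [Finset.card_singleton]
  -- every boundary contact sits at a ring site
  have hBsub : B.image (fun v => f + v) ⊆ SITES := by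
    intro p hp
    obtain ⟨v, hv, rfl⟩ := Finset.mem_image.1 hp
    obtain ⟨hvT, hv0⟩ := Finset.mem_filter.1 hv
    obtain ⟨q, hq, rfl⟩ := Finset.mem_image.1 hvT
    obtain ⟨hn, c₁, c₂, c₃, c₄, c₅, c₆⟩ := hsix q hq
    rw [hinner] at hv0
    have key := mem_hollowRing_of_boundary _ hn hv0 c₁ c₂ c₃ c₄ c₅ c₆
    have hq' : f + (q - f) = f + F (F.symm (q - f)) := by rw [LinearIsometryEquiv.apply_symm_apply]
    rw [hq', hSITES, Finset.mem_image]
    refine ⟨F.symm (q - f), ?_, rfl⟩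
    rcases key with h | h | h | h | h | h <;> simp [h]
  have hBcard : (B.image fun v => f + v).card = B.card :=
    Finset.card_image_of_injOn fun a _ b _ h => add_left_cancel h
  have heq : B.image (fun v => f + v) = SITES :=
    Finset.eq_of_subset_of_card_le hBsub (by rw [hBcard]; exact hScard.trans hB)
  -- conclusion: every ring site is a boundary contact, hence in `X`
  intro r hr
  have hmem : f + F r ∈ SITES := by rw [hSITES]; exact Finset.mem_image_of_mem _ hr
  rw [← heq] at hmem
  obtain ⟨v, hv, hve⟩ := Finset.mem_image.1 hmem
  obtain ⟨hvT, -⟩ := Finset.mem_filter.1 hv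
  obtain ⟨q, hq, rfl⟩ := Finset.mem_image.1 hvT
  rw [add_sub_cancel] at hve
  rw [← hve]
  exact (Finset.mem_filter.1 (hUN q hq).1).1

open scoped Classical in
/-- **A hollow ball with an empty ring site is short** (conditional on Kertész's theorem): under the hypotheses of
`hollowRing_subset_of_twelve_contacts`, if one of the six ring sites is NOT a ball of `X` then `f` has at most eleven contacts. -/
theorem card_contacts_le_eleven_of_hollowRing_vacancy (hK : Literature.Geometry.DiscreteGeometry.kertesz1994_nineHemisphere)
    (hX : ∀ p ∈ X, ∀ q ∈ X, p ≠ q → 1 ≤ dist p q)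
    (F : EuclideanSpace ℝ (Fin 3) ≃ₗᵢ[ℝ] EuclideanSpace ℝ (Fin 3)) {f : EuclideanSpace ℝ (Fin 3)}
    (h₁ : f + F !₂[-(1 / 2), -(Real.sqrt 3 / 6), -Real.sqrt (2 / 3)] ∈ X)
    (h₂ : f + F !₂[1 / 2, -(Real.sqrt 3 / 6), -Real.sqrt (2 / 3)] ∈ X)
    (h₃ : f + F !₂[0, Real.sqrt 3 / 3, -Real.sqrt (2 / 3)] ∈ X)
    (h₄ : f + F !₂[1, Real.sqrt 3 / 3, -Real.sqrt (2 / 3)] ∈ X)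
    (h₅ : f + F !₂[-1, Real.sqrt 3 / 3, -Real.sqrt (2 / 3)] ∈ X)
    (h₆ : f + F !₂[0, -(2 * Real.sqrt 3 / 3), -Real.sqrt (2 / 3)] ∈ X)
    {r : EuclideanSpace ℝ (Fin 3)}
    (hr : r ∈ ({!₂[1, 0, 0], !₂[-1, 0, 0], !₂[1 / 2, Real.sqrt 3 / 2, 0], !₂[-(1 / 2), -(Real.sqrt 3 / 2), 0],
      !₂[1 / 2, -(Real.sqrt 3 / 2), 0], !₂[-(1 / 2), Real.sqrt 3 / 2, 0]} : Finset (EuclideanSpace ℝ (Fin 3))))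
    (hvac : f + F r ∉ X) :
    (X.filter fun q => dist f q = 1).card ≤ 11 := by
  by_contra hgt
  have h12 : (X.filter fun q => dist f q = 1).card = 12 :=
    le_antisymm (card_filter_dist_eq_one_le_twelve X hX f) (by omega)
  exact hvac (hollowRing_subset_of_twelve_contacts hK hX F h₁ h₂ h₃ h₄ h₅ h₆ h12 r hr)

end Summit.Ventures.Crystal3D.Theorems

end
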